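import Summits.Parity.GeneralizedHardyLittlewood.Theorems.BeyondDiagonalBeatsQuarter.OffDiagDualLedgerMainScale
import Summits.Parity.GeneralizedHardyLittlewood.Theorems.BeyondDiagonalBeatsQuarter.OffDiagDualTruncationBox
import HarnessLib

/-!
# Route `PrimeLevelFamEdge`, crux K_B (stmt-Parity-20343), line `diagonal_kernel_split` rev 4, plan Ω,
# worker key K2 (part b) `OffDiagCoreLedgerTail`: **ONE monomial for L2's explicit tail constant and the
# weighted second-frequency tail of one box — `q(r+1)·Σ_{|h₂|>H₂}‖Φ̂_i‖ ≤ 𝓚_k·q^{61}·q^{−kε₀}`**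

L2 (`OffDiagDualTruncationBox.tsum_tail_snd_norm_fourier2_boxWeight_le`, prover-2) bounds the `|h₂| > H` tail of
the dual series of one box weight by an explicit constant times `H·Q^{−k}` once `H ≥ q(r+1)·D₂·Q/(2π)`. On the
ranges of the finite dual core (`r+1 ≤ q⁷`, `α, β ≤ q`, near boxes `2^{i_j} ≤ q⁵`, `d_j ≥ 1`) every atom of
that constant is a monomial in `q`:
* `rpow_neg_half_le_two`, `sizeFactor_le_four` (`(dd′K/2)^{-1/2}r⁻¹(K′/2)^{-1/2} ≤ 4`), `dTerm_le`
  (`q(r+1)·D_j/(2π) ≤ 11q^{14}`), **`tailBracket_snd_le`** (the whole bracket `≤ (18S_k + 7260√(S_{2k}S₄))·q^{38}`,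
  `S_n` the dyadic-bump derivative sums, in L2's verbatim syntactic shape);
* **`boxTail_snd_le`** / `exists_boxTail_snd_le` — with `H₂ = ⌈q(r+1)·D₂·q^{ε₀}/(2π)⌉ ≤ 12q^{15}`, `Q = q^{ε₀}`
  (`0 ≤ ε₀ ≤ 1`), `k ≥ 2` and the multiplicity weight `q(r+1) ≤ q⁸`:
  `q(r+1)·Σ_{h∈ℤ², |h₂|>H₂} ‖Φ̂_i(h/(q(r+1)))‖ ≤ 12(18S_k + 7260√(S_{2k}S₄))·q^{61}·(q^{ε₀})^{−k}`.
Consumed by `OffDiagCoreLedger` (`k = ⌈74/ε₀⌉ + 2` makes the whole tail `O(1) ≤ ms`). Crude exponents on purpose.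
Bookkeeping; nothing about the heart. Helper (`--supports stmt-Parity-20343`); standard axioms.
«The programme SEARCHES and TYPES; no claim about Landau–Siegel zeros, Theorems 1–2 of arXiv:2211.02515 or
a repaired Margin232 until a kernel theorem says so.»
-/

noncomputable section

open Finset Polynomial
open scoped Real Nat

namespace Summit.Parity.GeneralizedHardyLittlewood.Theorems.BeyondDiagonalBeatsQuarter.OffDiag

open Literature.NumberTheory.LFunctions Literature.NumberTheory.LFunctions.KMV2000
open Literature.NumberTheory.Sieve.FriedlanderIwaniecPrimes (fourier2)
open Literature.Analysis.Calculus.WhitneyConvex (dyadicBumpBound dyadicBumpBound_nonneg)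
open PeterssonSplit (two_pi_mul_qhat_sq qhat_sq_le)

/-! ### §1. Monomial bounds for L2's explicit constants -/

/-- `x^{-1/2} ≤ 2` for `x ≥ 1/2`. [folklore] -/
theorem rpow_neg_half_le_two {x : ℝ} (hx : 1 / 2 ≤ x) : x ^ (-(1 : ℝ) / 2) ≤ 2 := by
  have hx0 : 0 < x := lt_of_lt_of_le (by norm_num) hx
  have hs : 1 / 2 ≤ Real.sqrt x := Real.le_sqrt_of_sq_le (by nlinarith)
  have hs0 : 0 < Real.sqrt x := lt_of_lt_of_le (by norm_num) hs
  rw [show (-(1 : ℝ) / 2) = -((1 : ℝ) / 2) by ring, Real.rpow_neg hx0.le, ← Real.sqrt_eq_rpow]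
  rw [inv_le_comm₀ hs0 (by norm_num)]
  linarith

/-- The size factor of L2's box costs: `(dd′K/2)^{-1/2}·r⁻¹·(K′/2)^{-1/2} ≤ 4` for `d, d′, K, K′, r ≥ 1`. [folklore] -/
theorem sizeFactor_le_four {d d' K K' r : ℝ} (hd : 1 ≤ d) (hd' : 1 ≤ d') (hK : 1 ≤ K) (hK' : 1 ≤ K')
    (hr : 1 ≤ r) : (d * d' * (K / 2)) ^ (-(1 : ℝ) / 2) * r⁻¹ * (K' / 2) ^ (-(1 : ℝ) / 2) ≤ 4 := by
  have h1 : (d * d' * (K / 2)) ^ (-(1 : ℝ) / 2) ≤ 2 := by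
    refine rpow_neg_half_le_two ?_
    have : 1 ≤ d * d' := one_le_mul_of_one_le_of_one_le hd hd'
    nlinarith
  have h2 : r⁻¹ ≤ 1 := inv_le_one_of_one_le₀ hr
  have h3 : (K' / 2) ^ (-(1 : ℝ) / 2) ≤ 2 := rpow_neg_half_le_two (by linarith)
  have h10 : 0 ≤ (d * d' * (K / 2)) ^ (-(1 : ℝ) / 2) := by positivity
  have h20 : 0 ≤ r⁻¹ := by positivity
  calc _ ≤ 2 * 1 * 2 := mul_le_mul (mul_le_mul h1 h2 h20 (by norm_num)) h3 (by positivity) (by norm_num)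
    _ = 4 := by norm_num

/-- The dual-length factor of L2: `c·((1 + 4π√(αβ·2K)/den·√(2K′))/(K′/2))/(2π) ≤ 11q^{14}` once `αβ ≤ q²`,
`K, K′ ≤ q⁵`, `K′ ≥ 1`, `den ≥ 1`, `c ≤ q⁸`, `q ≥ 1`. [folklore] -/
theorem dTerm_le {α β K K' den c q : ℝ} (hq : 1 ≤ q) (hα : 0 ≤ α) (hβ : 0 ≤ β) (hαβ : α * β ≤ q ^ 2)
    (hK0 : 0 ≤ K) (hK : K ≤ q ^ 5) (hK'1 : 1 ≤ K') (hK' : K' ≤ q ^ 5) (hden : 1 ≤ den)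
    (hc : c ≤ q ^ 8) :
    c * ((1 + 4 * π * Real.sqrt (α * β * (2 * K)) / den * Real.sqrt (2 * K')) / (K' / 2)) / (2 * π) ≤
      11 * q ^ 14 := by
  have hπ3 : 3 < π := Real.pi_gt_three
  have hπ4 : π < 4 := Real.pi_lt_four
  have hq6 : 1 ≤ q ^ 6 := one_le_pow₀ hq
  have hπq : π * q ^ 6 ≤ 4 * q ^ 6 := mul_le_mul_of_nonneg_right hπ4.le (by positivity)
  -- the square roots
  have hsq : Real.sqrt (α * β * (2 * K)) * Real.sqrt (2 * K') ≤ 2 * q ^ 6 := by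
    rw [sqrt_two_mul_sqrt_two_mul K' hα hβ hK0]
    have hin : α * β * (K' * K) ≤ (q ^ 6) ^ 2 := by
      calc α * β * (K' * K) ≤ q ^ 2 * (q ^ 5 * q ^ 5) :=
            mul_le_mul hαβ (mul_le_mul hK' hK hK0 (by positivity)) (by positivity) (by positivity)
        _ = (q ^ 6) ^ 2 := by ring
    have := Real.sqrt_le_sqrt hin
    rw [Real.sqrt_sq (by positivity)] at this
    linarith
  have hfrac : 4 * π * Real.sqrt (α * β * (2 * K)) / den * Real.sqrt (2 * K') ≤ 8 * π * q ^ 6 := by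
    rw [div_mul_eq_mul_div, div_le_iff₀ (by linarith)]
    calc 4 * π * Real.sqrt (α * β * (2 * K)) * Real.sqrt (2 * K')
        = 4 * π * (Real.sqrt (α * β * (2 * K)) * Real.sqrt (2 * K')) := by ring
      _ ≤ 4 * π * (2 * q ^ 6) := mul_le_mul_of_nonneg_left hsq (by positivity)
      _ = 8 * π * q ^ 6 * 1 := by ring
      _ ≤ 8 * π * q ^ 6 * den := mul_le_mul_of_nonneg_left hden (by positivity)
  have hnum : (1 + 4 * π * Real.sqrt (α * β * (2 * K)) / den * Real.sqrt (2 * K')) / (K' / 2) ≤ 66 * q ^ 6 := by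
    rw [div_le_iff₀ (by linarith)]
    have h33 : 1 + 4 * π * Real.sqrt (α * β * (2 * K)) / den * Real.sqrt (2 * K') ≤ 33 * q ^ 6 := by
      linarith
    calc _ ≤ 33 * q ^ 6 := h33
      _ = 66 * q ^ 6 * (1 / 2) := by ring
      _ ≤ 66 * q ^ 6 * (K' / 2) := by gcongr
  have hnum0 : 0 ≤ (1 + 4 * π * Real.sqrt (α * β * (2 * K)) / den * Real.sqrt (2 * K')) / (K' / 2) := by
    positivity
  rw [div_le_iff₀ (by positivity)]
  calc c * ((1 + 4 * π * Real.sqrt (α * β * (2 * K)) / den * Real.sqrt (2 * K')) / (K' / 2))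
      ≤ q ^ 8 * (66 * q ^ 6) := mul_le_mul hc hnum hnum0 (by positivity)
    _ = 11 * q ^ 14 * 6 := by ring
    _ ≤ 11 * q ^ 14 * (2 * π) := by nlinarith [pow_nonneg (zero_le_one.trans hq) 14]

/-- **ONE monomial for L2's tail constant (second direction).** In the syntactic shape of
`OffDiagDualTruncationBox.tsum_tail_snd_norm_fourier2_boxWeight_le`: on the ranges of the finite dual core
(`2^{i_j} ≤ q⁵`, `αβ ≤ q²`, `d_j, r ≥ 1`, `qr ≥ 1`, `0 ≤ c ≤ q⁸`) the bracket is
`≤ (18·S_k + 7260·√(S_{2k}S₄))·q^{38}` (`S_n` the derivative-cost sums of the dyadic bump).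
[cite: KowalskiMichelVanderKam2000, Lemma 3.3 p. 9 — derivation] -/
theorem tailBracket_snd_le {q d₁ d₂ α β r : ℕ} (hq : 1 ≤ q) (hd₁ : 1 ≤ d₁) (hd₂ : 1 ≤ d₂) (hr : 1 ≤ r)
    (hαq : (α : ℝ) ≤ q) (hβq : (β : ℝ) ≤ q) {i : ℕ × ℕ} (hK₁ : (2 : ℝ) ^ i.1 ≤ (q : ℝ) ^ 5)
    (hK₂ : (2 : ℝ) ^ i.2 ≤ (q : ℝ) ^ 5) {c : ℝ} (hc0 : 0 ≤ c) (hc : c ≤ (q : ℝ) ^ 8) (k : ℕ) :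
    2 * (((3 * 2 ^ i.1 / 2) * (3 * 2 ^ i.2 / 2) *
            (∑ j ∈ Finset.range (k + 1), ((k : ℕ).choose j : ℝ) * (2 ^ j * dyadicBumpBound j) *
              ((((k - j : ℕ) : ℝ) + 1) ^ 2 * (k - j) ! * ((k - j : ℕ) : ℝ) ^ (k - j))) *
            (((d₂ : ℝ) * d₁ * (2 ^ i.1 / 2)) ^ (-(1 : ℝ) / 2) * (r : ℝ)⁻¹ * ((2 : ℝ) ^ i.2 / 2) ^ (-(1 : ℝ) / 2))) +
          π ^ 2 / 3 * (c * ((1 + 4 * π * Real.sqrt ((α : ℝ) * β * (2 * 2 ^ i.2)) / ((q : ℝ) * r) * Real.sqrt (2 * 2 ^ i.1)) /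
            ((2 : ℝ) ^ i.1 / 2)) / (2 * π)) ^ 2 *
            Real.sqrt (((3 * 2 ^ i.1 / 2) * (3 * 2 ^ i.2 / 2) *
            (∑ j ∈ Finset.range ((2 * k) + 1), (((2 * k) : ℕ).choose j : ℝ) * (2 ^ j * dyadicBumpBound j) *
              (((((2 * k) - j : ℕ) : ℝ) + 1) ^ 2 * ((2 * k) - j) ! * (((2 * k) - j : ℕ) : ℝ) ^ ((2 * k) - j))) *
            (((d₂ : ℝ) * d₁ * (2 ^ i.1 / 2)) ^ (-(1 : ℝ) / 2) * (r : ℝ)⁻¹ * ((2 : ℝ) ^ i.2 / 2) ^ (-(1 : ℝ) / 2))) *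
              ((3 * 2 ^ i.2 / 2) * (3 * 2 ^ i.1 / 2) *
            (∑ j ∈ Finset.range (4 + 1), ((4 : ℕ).choose j : ℝ) * (2 ^ j * dyadicBumpBound j) *
              ((((4 - j : ℕ) : ℝ) + 1) ^ 2 * (4 - j) ! * ((4 - j : ℕ) : ℝ) ^ (4 - j))) *
            (((d₁ : ℝ) * d₂ * (2 ^ i.2 / 2)) ^ (-(1 : ℝ) / 2) * (r : ℝ)⁻¹ * ((2 : ℝ) ^ i.1 / 2) ^ (-(1 : ℝ) / 2))))) ≤
      (18 * (∑ j ∈ Finset.range (k + 1), ((k : ℕ).choose j : ℝ) * (2 ^ j * dyadicBumpBound j) *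
              ((((k - j : ℕ) : ℝ) + 1) ^ 2 * (k - j) ! * ((k - j : ℕ) : ℝ) ^ (k - j))) +
        7260 * Real.sqrt ((∑ j ∈ Finset.range ((2 * k) + 1), (((2 * k) : ℕ).choose j : ℝ) *
              (2 ^ j * dyadicBumpBound j) *
              (((((2 * k) - j : ℕ) : ℝ) + 1) ^ 2 * ((2 * k) - j) ! * (((2 * k) - j : ℕ) : ℝ) ^ ((2 * k) - j))) *
            (∑ j ∈ Finset.range (4 + 1), ((4 : ℕ).choose j : ℝ) * (2 ^ j * dyadicBumpBound j) *
              ((((4 - j : ℕ) : ℝ) + 1) ^ 2 * (4 - j) ! * ((4 - j : ℕ) : ℝ) ^ (4 - j))))) * (q : ℝ) ^ 38 := by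
  set S₁ : ℝ := ∑ j ∈ Finset.range (k + 1), ((k : ℕ).choose j : ℝ) * (2 ^ j * dyadicBumpBound j) *
      ((((k - j : ℕ) : ℝ) + 1) ^ 2 * (k - j) ! * ((k - j : ℕ) : ℝ) ^ (k - j)) with hS₁
  set S₂ : ℝ := ∑ j ∈ Finset.range ((2 * k) + 1), (((2 * k) : ℕ).choose j : ℝ) * (2 ^ j * dyadicBumpBound j) *
      (((((2 * k) - j : ℕ) : ℝ) + 1) ^ 2 * ((2 * k) - j) ! * (((2 * k) - j : ℕ) : ℝ) ^ ((2 * k) - j)) with hS₂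
  set S₃ : ℝ := ∑ j ∈ Finset.range (4 + 1), ((4 : ℕ).choose j : ℝ) * (2 ^ j * dyadicBumpBound j) *
      ((((4 - j : ℕ) : ℝ) + 1) ^ 2 * (4 - j) ! * ((4 - j : ℕ) : ℝ) ^ (4 - j)) with hS₃
  have hS₁0 : 0 ≤ S₁ := Finset.sum_nonneg fun j _ ↦ by
    have := dyadicBumpBound_nonneg j; positivity
  have hS₂0 : 0 ≤ S₂ := Finset.sum_nonneg fun j _ ↦ by
    have := dyadicBumpBound_nonneg j; positivity
  have hS₃0 : 0 ≤ S₃ := Finset.sum_nonneg fun j _ ↦ by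
    have := dyadicBumpBound_nonneg j; positivity
  set K₁ : ℝ := (2 : ℝ) ^ i.1 with hK₁d
  set K₂ : ℝ := (2 : ℝ) ^ i.2 with hK₂d
  have hq1 : (1 : ℝ) ≤ q := by exact_mod_cast hq
  have hK₁1 : 1 ≤ K₁ := one_le_pow₀ (by norm_num)
  have hK₂1 : 1 ≤ K₂ := one_le_pow₀ (by norm_num)
  have hd₁' : (1 : ℝ) ≤ d₁ := by exact_mod_cast hd₁
  have hd₂' : (1 : ℝ) ≤ d₂ := by exact_mod_cast hd₂
  have hr' : (1 : ℝ) ≤ r := by exact_mod_cast hr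
  have hα0 : (0 : ℝ) ≤ α := Nat.cast_nonneg _
  have hβ0 : (0 : ℝ) ≤ β := Nat.cast_nonneg _
  have hαβ : (α : ℝ) * β ≤ (q : ℝ) ^ 2 := by
    rw [sq]; exact mul_le_mul hαq hβq hβ0 (by positivity)
  have hden : (1 : ℝ) ≤ (q : ℝ) * r := one_le_mul_of_one_le_of_one_le hq1 hr'
  -- the factors
  have hP : (3 * K₁ / 2) * (3 * K₂ / 2) ≤ 9 / 4 * (q : ℝ) ^ 10 := by
    calc (3 * K₁ / 2) * (3 * K₂ / 2) = 9 / 4 * (K₁ * K₂) := by ring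
      _ ≤ 9 / 4 * ((q : ℝ) ^ 5 * (q : ℝ) ^ 5) := by gcongr
      _ = 9 / 4 * (q : ℝ) ^ 10 := by ring
  have hP' : (3 * K₂ / 2) * (3 * K₁ / 2) ≤ 9 / 4 * (q : ℝ) ^ 10 := by rw [mul_comm]; exact hP
  have hE₁ : ((d₂ : ℝ) * d₁ * (K₁ / 2)) ^ (-(1 : ℝ) / 2) * (r : ℝ)⁻¹ * (K₂ / 2) ^ (-(1 : ℝ) / 2) ≤ 4 :=
    sizeFactor_le_four hd₂' hd₁' hK₁1 hK₂1 hr'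
  have hE₂ : ((d₁ : ℝ) * d₂ * (K₂ / 2)) ^ (-(1 : ℝ) / 2) * (r : ℝ)⁻¹ * (K₁ / 2) ^ (-(1 : ℝ) / 2) ≤ 4 :=
    sizeFactor_le_four hd₁' hd₂' hK₂1 hK₁1 hr'
  have hD : c * ((1 + 4 * π * Real.sqrt ((α : ℝ) * β * (2 * K₂)) / ((q : ℝ) * r) * Real.sqrt (2 * K₁)) /
      (K₁ / 2)) / (2 * π) ≤ 11 * (q : ℝ) ^ 14 :=
    dTerm_le hq1 hα0 hβ0 hαβ (by positivity) hK₂ hK₁1 hK₁ hden hc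
  have hD0 : 0 ≤ c * ((1 + 4 * π * Real.sqrt ((α : ℝ) * β * (2 * K₂)) / ((q : ℝ) * r) * Real.sqrt (2 * K₁)) /
      (K₁ / 2)) / (2 * π) := by positivity
  -- term 1
  have hT1 : (3 * K₁ / 2) * (3 * K₂ / 2) * S₁ *
      (((d₂ : ℝ) * d₁ * (K₁ / 2)) ^ (-(1 : ℝ) / 2) * (r : ℝ)⁻¹ * (K₂ / 2) ^ (-(1 : ℝ) / 2)) ≤
      9 * S₁ * (q : ℝ) ^ 10 := by
    calc _ ≤ (9 / 4 * (q : ℝ) ^ 10) * S₁ * 4 :=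
          mul_le_mul (mul_le_mul_of_nonneg_right hP hS₁0) hE₁ (by positivity) (by positivity)
      _ = 9 * S₁ * (q : ℝ) ^ 10 := by ring
  -- the square root
  have hR : Real.sqrt (((3 * K₁ / 2) * (3 * K₂ / 2) * S₂ *
      (((d₂ : ℝ) * d₁ * (K₁ / 2)) ^ (-(1 : ℝ) / 2) * (r : ℝ)⁻¹ * (K₂ / 2) ^ (-(1 : ℝ) / 2))) *
      ((3 * K₂ / 2) * (3 * K₁ / 2) * S₃ *
      (((d₁ : ℝ) * d₂ * (K₂ / 2)) ^ (-(1 : ℝ) / 2) * (r : ℝ)⁻¹ * (K₁ / 2) ^ (-(1 : ℝ) / 2)))) ≤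
      9 * (q : ℝ) ^ 10 * Real.sqrt (S₂ * S₃) := by
    have hin : ((3 * K₁ / 2) * (3 * K₂ / 2) * S₂ *
        (((d₂ : ℝ) * d₁ * (K₁ / 2)) ^ (-(1 : ℝ) / 2) * (r : ℝ)⁻¹ * (K₂ / 2) ^ (-(1 : ℝ) / 2))) *
        ((3 * K₂ / 2) * (3 * K₁ / 2) * S₃ *
        (((d₁ : ℝ) * d₂ * (K₂ / 2)) ^ (-(1 : ℝ) / 2) * (r : ℝ)⁻¹ * (K₁ / 2) ^ (-(1 : ℝ) / 2))) ≤
        (9 * (q : ℝ) ^ 10) ^ 2 * (S₂ * S₃) := by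
      have h2 : (3 * K₁ / 2) * (3 * K₂ / 2) * S₂ *
          (((d₂ : ℝ) * d₁ * (K₁ / 2)) ^ (-(1 : ℝ) / 2) * (r : ℝ)⁻¹ * (K₂ / 2) ^ (-(1 : ℝ) / 2)) ≤
          9 * (q : ℝ) ^ 10 * S₂ := by
        calc _ ≤ (9 / 4 * (q : ℝ) ^ 10) * S₂ * 4 :=
              mul_le_mul (mul_le_mul_of_nonneg_right hP hS₂0) hE₁ (by positivity) (by positivity)
          _ = 9 * (q : ℝ) ^ 10 * S₂ := by ring
      have h3 : (3 * K₂ / 2) * (3 * K₁ / 2) * S₃ *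
          (((d₁ : ℝ) * d₂ * (K₂ / 2)) ^ (-(1 : ℝ) / 2) * (r : ℝ)⁻¹ * (K₁ / 2) ^ (-(1 : ℝ) / 2)) ≤
          9 * (q : ℝ) ^ 10 * S₃ := by
        calc _ ≤ (9 / 4 * (q : ℝ) ^ 10) * S₃ * 4 :=
              mul_le_mul (mul_le_mul_of_nonneg_right hP' hS₃0) hE₂ (by positivity) (by positivity)
          _ = 9 * (q : ℝ) ^ 10 * S₃ := by ring
      calc _ ≤ (9 * (q : ℝ) ^ 10 * S₂) * (9 * (q : ℝ) ^ 10 * S₃) :=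
            mul_le_mul h2 h3 (by positivity) (by positivity)
        _ = (9 * (q : ℝ) ^ 10) ^ 2 * (S₂ * S₃) := by ring
    calc _ ≤ Real.sqrt ((9 * (q : ℝ) ^ 10) ^ 2 * (S₂ * S₃)) := Real.sqrt_le_sqrt hin
      _ = 9 * (q : ℝ) ^ 10 * Real.sqrt (S₂ * S₃) := by
          rw [Real.sqrt_mul (by positivity), Real.sqrt_sq (by positivity)]
  -- term 2
  have hT2 : π ^ 2 / 3 * (c * ((1 + 4 * π * Real.sqrt ((α : ℝ) * β * (2 * K₂)) / ((q : ℝ) * r) *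
      Real.sqrt (2 * K₁)) / (K₁ / 2)) / (2 * π)) ^ 2 *
      Real.sqrt (((3 * K₁ / 2) * (3 * K₂ / 2) * S₂ *
      (((d₂ : ℝ) * d₁ * (K₁ / 2)) ^ (-(1 : ℝ) / 2) * (r : ℝ)⁻¹ * (K₂ / 2) ^ (-(1 : ℝ) / 2))) *
      ((3 * K₂ / 2) * (3 * K₁ / 2) * S₃ *
      (((d₁ : ℝ) * d₂ * (K₂ / 2)) ^ (-(1 : ℝ) / 2) * (r : ℝ)⁻¹ * (K₁ / 2) ^ (-(1 : ℝ) / 2)))) ≤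
      3630 * Real.sqrt (S₂ * S₃) * (q : ℝ) ^ 38 := by
    have hπ2 : π ^ 2 / 3 ≤ 10 / 3 := by
      have : π ^ 2 ≤ 10 := by nlinarith [Real.pi_lt_d2, Real.pi_gt_three]
      linarith
    have hD2 : (c * ((1 + 4 * π * Real.sqrt ((α : ℝ) * β * (2 * K₂)) / ((q : ℝ) * r) *
        Real.sqrt (2 * K₁)) / (K₁ / 2)) / (2 * π)) ^ 2 ≤ (11 * (q : ℝ) ^ 14) ^ 2 :=
      pow_le_pow_left₀ hD0 hD 2
    calc _ ≤ 10 / 3 * (11 * (q : ℝ) ^ 14) ^ 2 * (9 * (q : ℝ) ^ 10 * Real.sqrt (S₂ * S₃)) :=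
          mul_le_mul (mul_le_mul hπ2 hD2 (by positivity) (by positivity)) hR
            (Real.sqrt_nonneg _) (by positivity)
      _ = 3630 * Real.sqrt (S₂ * S₃) * (q : ℝ) ^ 38 := by ring
  have hT1' : (3 * K₁ / 2) * (3 * K₂ / 2) * S₁ *
      (((d₂ : ℝ) * d₁ * (K₁ / 2)) ^ (-(1 : ℝ) / 2) * (r : ℝ)⁻¹ * (K₂ / 2) ^ (-(1 : ℝ) / 2)) ≤
      9 * S₁ * (q : ℝ) ^ 38 :=
    hT1.trans (mul_le_mul_of_nonneg_left (pow_le_pow_right₀ hq1 (by norm_num)) (by positivity))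
  calc _ ≤ 2 * (9 * S₁ * (q : ℝ) ^ 38 + 3630 * Real.sqrt (S₂ * S₃) * (q : ℝ) ^ 38) :=
        mul_le_mul_of_nonneg_left (add_le_add hT1' hT2) (by norm_num)
    _ = (18 * S₁ + 7260 * Real.sqrt (S₂ * S₃)) * (q : ℝ) ^ 38 := by ring

/-! ### §2. One box: the weighted second-frequency tail beyond `H₂ = ⌈q(r+1)·D₂·q^{ε₀}/(2π)⌉` -/

/-- **Per box.** On the ranges of the finite dual core (`q, d_j, α, β ≥ 1`, `α, β ≤ q`, `r+1 ≤ q⁷`,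
`2^{i_j} ≤ q⁵`), for `0 ≤ ε₀ ≤ 1` and `k ≥ 2`, with `H₂ = ⌈q(r+1)·D₂·q^{ε₀}/(2π)⌉` (L2's second height):
`q(r+1)·Σ_{h∈ℤ², |h₂| > H₂} ‖Φ̂_i(h/(q(r+1)))‖ ≤ 12·(18S_k + 7260√(S_{2k}S₄))·q^{61}·(q^{ε₀})^{−k}`
(L2 `tsum_tail_snd_norm_fourier2_boxWeight_le` + `tailBracket_snd_le` + `H₂ ≤ 12q^{15}` + `q(r+1) ≤ q⁸`).
[cite: KowalskiMichelVanderKam2000, Lemma 3.3 p. 9 — derivation] -/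
theorem boxTail_snd_le {q : ℕ} [NeZero q] (hq : 1 ≤ q) {d₁ d₂ α β : ℕ} (hd₁ : 1 ≤ d₁) (hd₂ : 1 ≤ d₂)
    (hα : 1 ≤ α) (hβ : 1 ≤ β) (hαq : (α : ℝ) ≤ q) (hβq : (β : ℝ) ≤ q) {r : ℕ} (hr : r + 1 ≤ q ^ 7)
    {i : ℕ × ℕ} (hK₁ : (2 : ℝ) ^ i.1 ≤ (q : ℝ) ^ 5) (hK₂ : (2 : ℝ) ^ i.2 ≤ (q : ℝ) ^ 5)
    {ε₀ : ℝ} (hε₀ : 0 ≤ ε₀) (hε₁ : ε₀ ≤ 1) {k : ℕ} (hk : 2 ≤ k) :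
    ((q * (r + 1) : ℕ) : ℝ) * ∑' h : ℤ × ℤ,
        (if (⌈((q * (r + 1) : ℕ) : ℝ) * ((1 + 4 * π * Real.sqrt ((β : ℝ) * α * (2 * 2 ^ i.1)) /
              ((q : ℝ) * ((r + 1 : ℕ) : ℝ)) * Real.sqrt (2 * 2 ^ i.2)) / ((2 : ℝ) ^ i.2 / 2)) / (2 * π) *
              (q : ℝ) ^ ε₀⌉₊ : ℤ) < |h.2| then
          ‖fourier2 (boxWeight q d₁ d₂ α β (r + 1) i) (h.1 / (q * (r + 1) : ℕ)) (h.2 / (q * (r + 1) : ℕ))‖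
        else 0) ≤
      12 * (18 * (∑ j ∈ Finset.range (k + 1), ((k : ℕ).choose j : ℝ) * (2 ^ j * dyadicBumpBound j) *
              ((((k - j : ℕ) : ℝ) + 1) ^ 2 * (k - j) ! * ((k - j : ℕ) : ℝ) ^ (k - j))) +
        7260 * Real.sqrt ((∑ j ∈ Finset.range ((2 * k) + 1), (((2 * k) : ℕ).choose j : ℝ) *
              (2 ^ j * dyadicBumpBound j) *
              (((((2 * k) - j : ℕ) : ℝ) + 1) ^ 2 * ((2 * k) - j) ! * (((2 * k) - j : ℕ) : ℝ) ^ ((2 * k) - j))) *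
            (∑ j ∈ Finset.range (4 + 1), ((4 : ℕ).choose j : ℝ) * (2 ^ j * dyadicBumpBound j) *
              ((((4 - j : ℕ) : ℝ) + 1) ^ 2 * (4 - j) ! * ((4 - j : ℕ) : ℝ) ^ (4 - j))))) * (q : ℝ) ^ 61 * (((q : ℝ) ^ ε₀) ^ k)⁻¹ := by
  set c : ℝ := ((q * (r + 1) : ℕ) : ℝ) with hc
  have hq1 : (1 : ℝ) ≤ q := by exact_mod_cast hq
  have hq0 : (0 : ℝ) < q := by linarith
  have hr1 : (1 : ℝ) ≤ ((r + 1 : ℕ) : ℝ) := by exact_mod_cast Nat.succ_pos r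
  have hc_eq : c = (q : ℝ) * ((r + 1 : ℕ) : ℝ) := by rw [hc]; push_cast; ring
  have hc0 : 0 < c := by rw [hc_eq]; positivity
  have hc8 : c ≤ (q : ℝ) ^ 8 := by
    have hr' : ((r + 1 : ℕ) : ℝ) ≤ (q : ℝ) ^ 7 := by exact_mod_cast hr
    calc c = (q : ℝ) * ((r + 1 : ℕ) : ℝ) := hc_eq
      _ ≤ (q : ℝ) * (q : ℝ) ^ 7 := mul_le_mul_of_nonneg_left hr' hq0.le
      _ = (q : ℝ) ^ 8 := by ring
  have hQ1 : (1 : ℝ) ≤ (q : ℝ) ^ ε₀ := Real.one_le_rpow hq1 hε₀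
  have hQq : (q : ℝ) ^ ε₀ ≤ q := by
    calc (q : ℝ) ^ ε₀ ≤ (q : ℝ) ^ (1 : ℝ) := Real.rpow_le_rpow_of_exponent_le hq1 hε₁
      _ = q := Real.rpow_one _
  have hα0 : (0 : ℝ) ≤ α := Nat.cast_nonneg _
  have hβ0 : (0 : ℝ) ≤ β := Nat.cast_nonneg _
  have hβα : (β : ℝ) * α ≤ (q : ℝ) ^ 2 := by
    rw [sq]; exact mul_le_mul hβq hαq hα0 (by positivity)
  have hden : (1 : ℝ) ≤ (q : ℝ) * ((r + 1 : ℕ) : ℝ) := one_le_mul_of_one_le_of_one_le hq1 hr1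
  -- the height
  set D : ℝ := c * ((1 + 4 * π * Real.sqrt ((β : ℝ) * α * (2 * 2 ^ i.1)) /
      ((q : ℝ) * ((r + 1 : ℕ) : ℝ)) * Real.sqrt (2 * 2 ^ i.2)) / ((2 : ℝ) ^ i.2 / 2)) / (2 * π) *
      (q : ℝ) ^ ε₀ with hD
  have hK₁1 : (1 : ℝ) ≤ (2 : ℝ) ^ i.1 := one_le_pow₀ (by norm_num)
  have hK₂1 : (1 : ℝ) ≤ (2 : ℝ) ^ i.2 := one_le_pow₀ (by norm_num)
  have hD0 : 0 < D := by rw [hD]; positivity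
  have hDle : D ≤ 11 * (q : ℝ) ^ 15 := by
    have h := dTerm_le (K := (2 : ℝ) ^ i.1) (K' := (2 : ℝ) ^ i.2) hq1 hβ0 hα0 hβα (by positivity) hK₁ hK₂1
      hK₂ hden hc8
    calc D ≤ 11 * (q : ℝ) ^ 14 * q := mul_le_mul h hQq (by positivity) (by positivity)
      _ = 11 * (q : ℝ) ^ 15 := by ring
  set H : ℕ := ⌈D⌉₊ with hH
  have hH1 : 1 ≤ H := Nat.one_le_iff_ne_zero.mpr (Nat.pos_iff_ne_zero.mp (Nat.ceil_pos.mpr hD0))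
  have hHle : (H : ℝ) ≤ 12 * (q : ℝ) ^ 15 := by
    have := natCeil_le_add_one hD0.le hDle
    have h15 : (1 : ℝ) ≤ (q : ℝ) ^ 15 := one_le_pow₀ hq1
    rw [hH]; linarith
  have hlen : c * ((1 + 4 * π * Real.sqrt ((β : ℝ) * α * (2 * 2 ^ i.1)) /
      ((q : ℝ) * ((r + 1 : ℕ) : ℝ)) * Real.sqrt (2 * 2 ^ i.2)) / ((2 : ℝ) ^ i.2 / 2)) / (2 * π) *
      (q : ℝ) ^ ε₀ ≤ H := Nat.le_ceil D
  -- L2's tail bound and the monomial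
  have htail := OffDiagPoissonTwisted.tsum_tail_snd_norm_fourier2_boxWeight_le (q := q) (r := r + 1)
    hd₁ hd₂ hα hβ i hc0 hk hH1 hQ1 hlen
  have hBR := tailBracket_snd_le (q := q) (d₁ := d₁) (d₂ := d₂) (α := α) (β := β) (r := r + 1) (i := i)
    hq hd₁ hd₂ (Nat.succ_pos r) hαq hβq hK₁ hK₂ hc0.le hc8 k
  have hQk0 : 0 ≤ (((q : ℝ) ^ ε₀) ^ k)⁻¹ := by positivity
  have h𝓚0 : 0 ≤ 18 * (∑ j ∈ Finset.range (k + 1), ((k : ℕ).choose j : ℝ) * (2 ^ j * dyadicBumpBound j) *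
              ((((k - j : ℕ) : ℝ) + 1) ^ 2 * (k - j) ! * ((k - j : ℕ) : ℝ) ^ (k - j))) + 7260 * Real.sqrt ((∑ j ∈ Finset.range ((2 * k) + 1), (((2 * k) : ℕ).choose j : ℝ) *
              (2 ^ j * dyadicBumpBound j) *
              (((((2 * k) - j : ℕ) : ℝ) + 1) ^ 2 * ((2 * k) - j) ! * (((2 * k) - j : ℕ) : ℝ) ^ ((2 * k) - j))) *
            (∑ j ∈ Finset.range (4 + 1), ((4 : ℕ).choose j : ℝ) * (2 ^ j * dyadicBumpBound j) *
              ((((4 - j : ℕ) : ℝ) + 1) ^ 2 * (4 - j) ! * ((4 - j : ℕ) : ℝ) ^ (4 - j)))) := by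
    have h1 : 0 ≤ (∑ j ∈ Finset.range (k + 1), ((k : ℕ).choose j : ℝ) * (2 ^ j * dyadicBumpBound j) *
              ((((k - j : ℕ) : ℝ) + 1) ^ 2 * (k - j) ! * ((k - j : ℕ) : ℝ) ^ (k - j))) := Finset.sum_nonneg fun j _ ↦ by
      have := dyadicBumpBound_nonneg j; positivity
    positivity
  calc c * _ ≤ (q : ℝ) ^ 8 * ((18 * (∑ j ∈ Finset.range (k + 1), ((k : ℕ).choose j : ℝ) * (2 ^ j * dyadicBumpBound j) *
              ((((k - j : ℕ) : ℝ) + 1) ^ 2 * (k - j) ! * ((k - j : ℕ) : ℝ) ^ (k - j))) + 7260 * Real.sqrt ((∑ j ∈ Finset.range ((2 * k) + 1), (((2 * k) : ℕ).choose j : ℝ) *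
              (2 ^ j * dyadicBumpBound j) *
              (((((2 * k) - j : ℕ) : ℝ) + 1) ^ 2 * ((2 * k) - j) ! * (((2 * k) - j : ℕ) : ℝ) ^ ((2 * k) - j))) *
            (∑ j ∈ Finset.range (4 + 1), ((4 : ℕ).choose j : ℝ) * (2 ^ j * dyadicBumpBound j) *
              ((((4 - j : ℕ) : ℝ) + 1) ^ 2 * (4 - j) ! * ((4 - j : ℕ) : ℝ) ^ (4 - j))))) * (q : ℝ) ^ 38 * H * (((q : ℝ) ^ ε₀) ^ k)⁻¹) := by
        refine mul_le_mul hc8 (htail.trans ?_) (tsum_nonneg fun h ↦ by split_ifs <;> positivity)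
          (by positivity)
        exact mul_le_mul_of_nonneg_right (mul_le_mul_of_nonneg_right hBR (Nat.cast_nonneg _)) hQk0
    _ ≤ (q : ℝ) ^ 8 * ((18 * (∑ j ∈ Finset.range (k + 1), ((k : ℕ).choose j : ℝ) * (2 ^ j * dyadicBumpBound j) *
              ((((k - j : ℕ) : ℝ) + 1) ^ 2 * (k - j) ! * ((k - j : ℕ) : ℝ) ^ (k - j))) + 7260 * Real.sqrt ((∑ j ∈ Finset.range ((2 * k) + 1), (((2 * k) : ℕ).choose j : ℝ) *
              (2 ^ j * dyadicBumpBound j) *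
              (((((2 * k) - j : ℕ) : ℝ) + 1) ^ 2 * ((2 * k) - j) ! * (((2 * k) - j : ℕ) : ℝ) ^ ((2 * k) - j))) *
            (∑ j ∈ Finset.range (4 + 1), ((4 : ℕ).choose j : ℝ) * (2 ^ j * dyadicBumpBound j) *
              ((((4 - j : ℕ) : ℝ) + 1) ^ 2 * (4 - j) ! * ((4 - j : ℕ) : ℝ) ^ (4 - j))))) * (q : ℝ) ^ 38 * (12 * (q : ℝ) ^ 15) *
          (((q : ℝ) ^ ε₀) ^ k)⁻¹) := by
        gcongr
    _ = 12 * (18 * (∑ j ∈ Finset.range (k + 1), ((k : ℕ).choose j : ℝ) * (2 ^ j * dyadicBumpBound j) *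
              ((((k - j : ℕ) : ℝ) + 1) ^ 2 * (k - j) ! * ((k - j : ℕ) : ℝ) ^ (k - j))) + 7260 * Real.sqrt ((∑ j ∈ Finset.range ((2 * k) + 1), (((2 * k) : ℕ).choose j : ℝ) *
              (2 ^ j * dyadicBumpBound j) *
              (((((2 * k) - j : ℕ) : ℝ) + 1) ^ 2 * ((2 * k) - j) ! * (((2 * k) - j : ℕ) : ℝ) ^ ((2 * k) - j))) *
            (∑ j ∈ Finset.range (4 + 1), ((4 : ℕ).choose j : ℝ) * (2 ^ j * dyadicBumpBound j) *
              ((((4 - j : ℕ) : ℝ) + 1) ^ 2 * (4 - j) ! * ((4 - j : ℕ) : ℝ) ^ (4 - j))))) * (q : ℝ) ^ 61 * (((q : ℝ) ^ ε₀) ^ k)⁻¹ := by ring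

/-- The same, with the constant packaged: for `k ≥ 2` and `0 ≤ ε₀ ≤ 1` there is `𝓚 ≥ 0` (depending on `k`
only) bounding every weighted box tail of the finite dual core by `𝓚·q^{61}·(q^{ε₀})^{−k}`.
[cite: KowalskiMichelVanderKam2000, Lemma 3.3 p. 9 — derivation] -/
theorem exists_boxTail_snd_le {k : ℕ} (hk : 2 ≤ k) {ε₀ : ℝ} (hε₀ : 0 ≤ ε₀) (hε₁ : ε₀ ≤ 1) :
    ∃ 𝓚 : ℝ, 0 ≤ 𝓚 ∧ ∀ (q : ℕ) [NeZero q] (d₁ d₂ α β r : ℕ) (i : ℕ × ℕ), 1 ≤ q → 1 ≤ d₁ → 1 ≤ d₂ →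
      1 ≤ α → 1 ≤ β → (α : ℝ) ≤ q → (β : ℝ) ≤ q → r + 1 ≤ q ^ 7 → (2 : ℝ) ^ i.1 ≤ (q : ℝ) ^ 5 →
      (2 : ℝ) ^ i.2 ≤ (q : ℝ) ^ 5 →
      ((q * (r + 1) : ℕ) : ℝ) * ∑' h : ℤ × ℤ,
        (if (⌈((q * (r + 1) : ℕ) : ℝ) * ((1 + 4 * π * Real.sqrt ((β : ℝ) * α * (2 * 2 ^ i.1)) /
              ((q : ℝ) * ((r + 1 : ℕ) : ℝ)) * Real.sqrt (2 * 2 ^ i.2)) / ((2 : ℝ) ^ i.2 / 2)) / (2 * π) *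
              (q : ℝ) ^ ε₀⌉₊ : ℤ) < |h.2| then
          ‖fourier2 (boxWeight q d₁ d₂ α β (r + 1) i) (h.1 / (q * (r + 1) : ℕ)) (h.2 / (q * (r + 1) : ℕ))‖
        else 0) ≤ 𝓚 * (q : ℝ) ^ 61 * (((q : ℝ) ^ ε₀) ^ k)⁻¹ := by
  refine ⟨12 * (18 * (∑ j ∈ Finset.range (k + 1), ((k : ℕ).choose j : ℝ) * (2 ^ j * dyadicBumpBound j) *
              ((((k - j : ℕ) : ℝ) + 1) ^ 2 * (k - j) ! * ((k - j : ℕ) : ℝ) ^ (k - j))) + 7260 * Real.sqrt ((∑ j ∈ Finset.range ((2 * k) + 1), (((2 * k) : ℕ).choose j : ℝ) *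
              (2 ^ j * dyadicBumpBound j) *
              (((((2 * k) - j : ℕ) : ℝ) + 1) ^ 2 * ((2 * k) - j) ! * (((2 * k) - j : ℕ) : ℝ) ^ ((2 * k) - j))) *
            (∑ j ∈ Finset.range (4 + 1), ((4 : ℕ).choose j : ℝ) * (2 ^ j * dyadicBumpBound j) *
              ((((4 - j : ℕ) : ℝ) + 1) ^ 2 * (4 - j) ! * ((4 - j : ℕ) : ℝ) ^ (4 - j))))), ?_, ?_⟩
  · have h1 : 0 ≤ (∑ j ∈ Finset.range (k + 1), ((k : ℕ).choose j : ℝ) * (2 ^ j * dyadicBumpBound j) *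
              ((((k - j : ℕ) : ℝ) + 1) ^ 2 * (k - j) ! * ((k - j : ℕ) : ℝ) ^ (k - j))) := Finset.sum_nonneg fun j _ ↦ by
      have := dyadicBumpBound_nonneg j; positivity
    positivity
  · intro q _ d₁ d₂ α β r i hq hd₁ hd₂ hα hβ hαq hβq hr hK₁ hK₂
    exact boxTail_snd_le hq hd₁ hd₂ hα hβ hαq hβq hr hK₁ hK₂ hε₀ hε₁ hk

end Summit.Parity.GeneralizedHardyLittlewood.Theorems.BeyondDiagonalBeatsQuarter.OffDiag
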